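import Summits.CriticalPhenomena.PercolationContinuityZ3.Theorems.PercNearOneGluingNoHeavyQuantPkConstants
import Mathlib.Analysis.Complex.ExponentialBounds
import Summits.CriticalPhenomena.PercolationContinuityZ3.Theorems.PercNearOneGluingNoHeavyQuantKnOrbitHigherD
import HarnessLib

/-!
# QUANT lane / PAPER-2 rate track (ARM-2 = constants bookkeeper, gen 2): the Peierls-lever cascade (`pkEps = 2⁻⁸`) to the last binary digit —
# `pkK = 62461` exactly, the closed form of `pkTauU d` for every `d ≥ 1`, and the ORBIT defects `pkTauU d ^ (d·2^d)` for `d = 3, 4, 5, 6`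

builds on p205010 (kernel theorem, internal audit signed; external expert review pending)

Cell `prim-quant`, seat `prim-quant-arm-2` (`run/shared/lean/prim/quant/prim-quant-arm-2/RATE-CONSTANTS.md` §2b; arm-4 ARM-REF N14).  ARM-1's Peierls
lever (RATE-PLAN v2.1 §11: `…QuantPeierlsStarGeometry` p243861, `…QuantPeierlsStarDriver` p244215) lowers the Peierls constant of the Kozma–Nitzan
site renormalisation from `2⁻³²` to `2⁻⁸`; `…QuantPkConstants` (p244107) re-runs the tolerance cascade at `pkEps = 2⁻⁸` and `…QuantPkConstantsCertified`
(p244647) certifies `62460 ≤ pkK ≤ 62461`, `(1/2)^115 < pkTauU 3 < (1/2)^114` and the 24-th-power bracket `(1/2)^2760 < pkTauU 3 ^ 24 < (1/2)^2736`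
(which loses the fractional binary digits 24 times over).  This file is the bookkeeper's certification of the new numbers, in the pattern of
`…QuantKnOrbitHigherD` (p213528) whose generic step `one_div_sandwich_of_nat` it reuses; it imports `…QuantPkConstants` only (p244647's brackets are not
needed: every sandwich is two kernel-decided integer comparisons at the exact value `pkK = 62461`):

* `PkSharp.pkK_eq` : **`pkK = 62461`** exactly (`⌈90112·log 2⌉ = ⌈62460.878…⌉`, from Mathlib's `0.6931471803 < log 2 < 0.6931471808`);
* `PkSharp.pkDeltaE_eq_closedForm`, `PkSharp.pkTauU_eq_closedForm`, `PkSharp.pkTauU_pow_closedForm` — for every `d ≥ 1`: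
  `pkTauU d ^ E = 1/(2^E · (2¹⁶ · (96(d+1))²·200 · pkK)^{2E})`;
* single tolerances: `(1/2)^115 < pkTauU 3 < (1/2)^114`, `(1/2)^116 < pkTauU 4 < (1/2)^115`, `(1/2)^117 < pkTauU 5 < (1/2)^116`,
  `(1/2)^118 < pkTauU 6 < (1/2)^117` (interval values `−114.489` (= p244647's), `−115.777`, `−116.829`, `−117.718`);
* **the orbit defects to the last binary digit** (interval values of `log₂`: `−2747.733`, `−7409.70`, `−18692.60`, `−45203.83`; second derivation
  `run/shared/lean/prim/quant/prim-quant-arm-2/code/eta_budget.py`, third arm-4 `recheck_g11.py`, all on exact rationals):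
  `PkSharp.orbit_three_sharp` : `(1/2)^2748  < pkTauU 3 ^ 24  < (1/2)^2747`;
  `PkSharp.orbit_four_sharp`  : `(1/2)^7410  < pkTauU 4 ^ 64  < (1/2)^7409`;
  `PkSharp.orbit_five_sharp`  : `(1/2)^18693 < pkTauU 5 ^ 160 < (1/2)^18692`;
  `PkSharp.orbit_six_sharp`   : `(1/2)^45204 < pkTauU 6 ^ 384 < (1/2)^45203`;
* what the lever buys, in the kernel: `PkSharp.two_pow_mul_knOrbit_lt_pkOrbit_three/four/five/six` — the `pk` orbit defect exceeds the tree's `kn` one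
  (`2⁻⁶²⁸⁴`, `2⁻¹⁶⁸⁴⁰`, `2⁻⁴²²⁶⁷`, `2⁻¹⁰¹⁷⁸³`, p213333/p213528) by factors `> 2^3535`, `2^9429`, `2^23573`, `2^56578`;
* HONEST SIZE of a display with base `1 − 2⁻²⁷⁴⁸` (Bernoulli only): `PkSharp.half_le_base_pow` / `PkSharp.base_pow_le_half` — `(1 − 2⁻²⁷⁴⁸)^e ≥ 1/2` for
  every `e ≤ 2^2747` and `≤ 1/2` for every `e ≥ 2^2748`: a rate printed with this base says nothing before its exponent exceeds `2^2747`.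

The displayed rates with these bases (`π_{p_c(ℤ^d)}(N) ≤ (1 − 2^{-a_d})^⌊(log*₂ N − 6)/2⌋`, `a = 2748, 7410, 18693, 45204`) wait for ARM-1's
`pkScaleDefect_criticalProbI(_orbit)` files; nothing here depends on them.  HONEST SENTENCE (unchanged): the proved rate at `p_c(ℤ^d)`, `d ≥ 3`, is of
iterated-logarithm type — explicit functions tending to `0` and nothing more; the lever moves the BASE only (class unchanged); polylog / power law OPEN.
No definitions, no sorries; standard axioms.  [cite: KozmaNitzan2024, §4 Theorem 6 (pp. 25–31)]
-/

noncomputable section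

namespace Summit.CriticalPhenomena.PercolationContinuityZ3.Theorems.Quant.PkSharp

open Literature.Probability.Percolation Literature.Probability.LatticeModels
open Literature.Probability.Percolation.GM (HOct)

variable {d : ℕ}

/-! ## `pkK = 62461` exactly -/

/-- **`pkK = 62461`** exactly: `pkK = max 64 ⌈log(8/ε)·32/ε⌉ = ⌈90112·log 2⌉` and `62460 < 62460.878… = 90112·log 2 ≤ 62461`
(Mathlib: `0.6931471803 < log 2 < 0.6931471808`).  builds on p205010 (kernel theorem, internal audit signed; external expert review pending).
[folklore] (numeric) -/
theorem pkK_eq : pkK = 62461 := by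
  have hlo := Real.log_two_gt_d9
  have hhi := Real.log_two_lt_d9
  -- the argument of the ceiling is `log(2¹¹)·2¹³ = 90112·log 2` (p244647's `pkK_arg_eq`, inlined so that this file needs `…QuantPkConstants` only)
  have harg : Real.log (8 / pkEps) * (32 / pkEps) = 90112 * Real.log 2 := by
    have hε : pkEps = (1 / 2) ^ 8 := rfl
    have h8 : (8 : ℝ) / pkEps = 2 ^ 11 := by rw [hε]; norm_num
    have h32 : (32 : ℝ) / pkEps = 2 ^ 13 := by rw [hε]; norm_num
    rw [h8, h32, Real.log_pow]
    push_cast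
    ring
  have hceil : ⌈Real.log (8 / pkEps) * (32 / pkEps)⌉₊ = 62461 := by
    rw [harg, Nat.ceil_eq_iff (by norm_num : (62461 : ℕ) ≠ 0)]
    constructor
    · norm_num at hlo ⊢; linarith
    · norm_num at hhi ⊢; linarith
  unfold pkK
  rw [hceil]
  norm_num

/-- `(pkK : ℝ) = 62461`. [folklore] (numeric) -/
theorem pkK_cast_eq : (pkK : ℝ) = 62461 := by rw [pkK_eq]; norm_num

/-! ## Closed form of `pkTauU d`, every `d ≥ 1` -/

/-- For `d ≥ 1` the corridor tolerance is the finer one: `pkDeltaCorr d = ε/(96(d+1)) ≤ ε/192 = pkDelta`. [folklore] -/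
theorem pkDeltaCorr_le_pkDelta (hd : 1 ≤ d) : pkDeltaCorr d ≤ pkDelta := by
  unfold pkDeltaCorr pkDelta
  have hε := pkEps_pos
  have hd' : (1 : ℝ) ≤ d := by exact_mod_cast hd
  exact div_le_div_of_nonneg_left hε.le (by norm_num) (by nlinarith)

/-- For `d ≥ 1`: `pkTau1 d = pkDeltaCorr d ²`. [folklore] -/
theorem pkTau1_eq_pkDeltaCorr_sq (hd : 1 ≤ d) : pkTau1 d = pkDeltaCorr d ^ 2 := by
  unfold pkTau1
  exact min_eq_right (pow_le_pow_left₀ (pkDeltaCorr_pos d).le (pkDeltaCorr_le_pkDelta hd) 2)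

/-- **Closed form of `pkDeltaE d`, `d ≥ 1`**: `pkDeltaE d = 1/(2¹⁶ · ((96(d+1))²·200) · pkK)` (`ε = 2⁻⁸`). [folklore] -/
theorem pkDeltaE_eq_closedForm (hd : 1 ≤ d) :
    pkDeltaE d = 1 / (2 ^ 16 * ((96 * ((d : ℝ) + 1)) ^ 2 * 200) * (pkK : ℝ)) := by
  unfold pkDeltaE
  rw [pkTau1_eq_pkDeltaCorr_sq hd]
  unfold pkDeltaCorr
  have hε : pkEps = (1 / 2) ^ 8 := rfl
  have hK0 : (0 : ℝ) < pkK := by exact_mod_cast pkK_pos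
  have hd0 : (0 : ℝ) < 96 * ((d : ℝ) + 1) := by positivity
  rw [hε]
  field_simp

/-- **Closed form of the uniqueness tolerance, `d ≥ 1`**: `pkTauU d = 1/(2 · (2¹⁶ · ((96(d+1))²·200) · pkK)²)`. [folklore] -/
theorem pkTauU_eq_closedForm (hd : 1 ≤ d) :
    pkTauU d = 1 / (2 * (2 ^ 16 * ((96 * ((d : ℝ) + 1)) ^ 2 * 200) * (pkK : ℝ)) ^ 2) := by
  unfold pkTauU
  rw [pkDeltaE_eq_closedForm hd]
  have hK0 : (0 : ℝ) < pkK := by exact_mod_cast pkK_pos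
  have hD : (0 : ℝ) < 2 ^ 16 * ((96 * ((d : ℝ) + 1)) ^ 2 * 200) * (pkK : ℝ) := by positivity
  field_simp

/-- Powers of the closed form: `pkTauU d ^ E = 1/(2^E · (2¹⁶ · ((96(d+1))²·200) · pkK)^{2E})`, `d ≥ 1`. [folklore] -/
theorem pkTauU_pow_closedForm (hd : 1 ≤ d) (E : ℕ) :
    pkTauU d ^ E = 1 / (2 ^ E * (2 ^ 16 * ((96 * ((d : ℝ) + 1)) ^ 2 * 200) * (pkK : ℝ)) ^ (2 * E)) := by
  rw [pkTauU_eq_closedForm hd, one_div_pow, mul_pow, ← pow_mul]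

/-- `pkTauU d ≤ 1` (indeed `< pkDeltaE d ² < pkDeltaE d < 1`). [folklore] -/
theorem pkTauU_le_one (d : ℕ) : pkTauU d ≤ 1 :=
  ((pkTauU_lt d).trans ((pkDeltaE_sq_lt d).trans (pkDeltaE_lt_one d))).le

/-- `pkTauU d ^ k ≤ 1`. [folklore] -/
theorem pkTauU_pow_le_one' (d k : ℕ) : pkTauU d ^ k ≤ 1 := pow_le_one₀ (pkTauU_pos d).le (pkTauU_le_one d)

/-! ## Single tolerances `pkTauU d`, `d = 3, 4, 5, 6` (the `d = 3` row is also p244647's `pow_lt_pkTauU_three` / `pkTauU_three_lt_pow`) -/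

/-- `pkTauU 3 = 1/(2 · (2¹⁶·29491200·pkK)²)` in cast form (`(96·4)²·200 = 29491200`). [folklore] -/
theorem pkTauU_three_eq : pkTauU 3 = 1 / (((2 : ℕ) : ℝ) * (((2 ^ 16 * 29491200 : ℕ) : ℝ) * (pkK : ℝ)) ^ 2) := by
  rw [pkTauU_eq_closedForm (by norm_num)]; push_cast; norm_num

/-- **`(1/2)^115 < pkTauU 3 < (1/2)^114`** (interval value `log₂ = −114.489`). [folklore] (numeric) -/
theorem pkTauU_three_sharp : (1 / 2 : ℝ) ^ 115 < pkTauU 3 ∧ pkTauU 3 < (1 / 2 : ℝ) ^ 114 := by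
  rw [pkTauU_three_eq]
  exact one_div_sandwich_of_nat (A := 2) (C := 2 ^ 16 * 29491200) (Klo := 62461) (Khi := 62461) (K := pkK) (n := 2) (a := 114)
    (by norm_num) (by positivity) (by norm_num) pkK_eq.ge pkK_eq.le (by decide +kernel) (by decide +kernel)


/-- `pkTauU 4 = 1/(2 · (2¹⁶·46080000·pkK)²)` in cast form (`(96·5)²·200 = 46080000`). [folklore] -/
theorem pkTauU_four_eq : pkTauU 4 = 1 / (((2 : ℕ) : ℝ) * (((2 ^ 16 * 46080000 : ℕ) : ℝ) * (pkK : ℝ)) ^ 2) := by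
  rw [pkTauU_eq_closedForm (by norm_num)]; push_cast; norm_num

/-- **`(1/2)^116 < pkTauU 4 < (1/2)^115`** (interval value `log₂ = −115.777`). [folklore] (numeric) -/
theorem pkTauU_four_sharp : (1 / 2 : ℝ) ^ 116 < pkTauU 4 ∧ pkTauU 4 < (1 / 2 : ℝ) ^ 115 := by
  rw [pkTauU_four_eq]
  exact one_div_sandwich_of_nat (A := 2) (C := 2 ^ 16 * 46080000) (Klo := 62461) (Khi := 62461) (K := pkK) (n := 2) (a := 115)
    (by norm_num) (by positivity) (by norm_num) pkK_eq.ge pkK_eq.le (by decide +kernel) (by decide +kernel)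

/-- `pkTauU 5 = 1/(2 · (2¹⁶·66355200·pkK)²)` in cast form (`(96·6)²·200 = 66355200`). [folklore] -/
theorem pkTauU_five_eq : pkTauU 5 = 1 / (((2 : ℕ) : ℝ) * (((2 ^ 16 * 66355200 : ℕ) : ℝ) * (pkK : ℝ)) ^ 2) := by
  rw [pkTauU_eq_closedForm (by norm_num)]; push_cast; norm_num

/-- **`(1/2)^117 < pkTauU 5 < (1/2)^116`** (interval value `log₂ = −116.829`). [folklore] (numeric) -/
theorem pkTauU_five_sharp : (1 / 2 : ℝ) ^ 117 < pkTauU 5 ∧ pkTauU 5 < (1 / 2 : ℝ) ^ 116 := by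
  rw [pkTauU_five_eq]
  exact one_div_sandwich_of_nat (A := 2) (C := 2 ^ 16 * 66355200) (Klo := 62461) (Khi := 62461) (K := pkK) (n := 2) (a := 116)
    (by norm_num) (by positivity) (by norm_num) pkK_eq.ge pkK_eq.le (by decide +kernel) (by decide +kernel)

/-- `pkTauU 6 = 1/(2 · (2¹⁶·90316800·pkK)²)` in cast form (`(96·7)²·200 = 90316800`). [folklore] -/
theorem pkTauU_six_eq : pkTauU 6 = 1 / (((2 : ℕ) : ℝ) * (((2 ^ 16 * 90316800 : ℕ) : ℝ) * (pkK : ℝ)) ^ 2) := by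
  rw [pkTauU_eq_closedForm (by norm_num)]; push_cast; norm_num

/-- **`(1/2)^118 < pkTauU 6 < (1/2)^117`** (interval value `log₂ = −117.718`). [folklore] (numeric) -/
theorem pkTauU_six_sharp : (1 / 2 : ℝ) ^ 118 < pkTauU 6 ∧ pkTauU 6 < (1 / 2 : ℝ) ^ 117 := by
  rw [pkTauU_six_eq]
  exact one_div_sandwich_of_nat (A := 2) (C := 2 ^ 16 * 90316800) (Klo := 62461) (Khi := 62461) (K := pkK) (n := 2) (a := 117)
    (by norm_num) (by positivity) (by norm_num) pkK_eq.ge pkK_eq.le (by decide +kernel) (by decide +kernel)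

/-! ## The orbit defects `pkTauU d ^ (d·2^d)` to the last binary digit -/

/-- `pkTauU 3 ^ (3·2^3) = 1/(2^24 · (2¹⁶·29491200·pkK)^48)` in the cast form of `one_div_sandwich_of_nat` (`(96·4)²·200 = 29491200`). [folklore] -/
theorem pkTauU_pow_orbit_three_eq :
    pkTauU 3 ^ (3 * 2 ^ 3) = 1 / (((2 ^ 24 : ℕ) : ℝ) * (((2 ^ 16 * 29491200 : ℕ) : ℝ) * (pkK : ℝ)) ^ 48) := by
  rw [show (3 : ℕ) * 2 ^ 3 = 24 by norm_num, pkTauU_pow_closedForm (by norm_num) 24]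
  push_cast
  norm_num

/-- **`(1/2)^2748 < pkTauU 3 ^ (3·2^3) < (1/2)^2747`** — the Peierls-lever orbit defect on `ℤ³` to the last binary digit (interval value
`log₂ = −2747.733`; the tree's `kn` value is `−6283.886`, p213333).  builds on p205010 (kernel theorem, internal audit signed; external expert
review pending). [folklore] (numeric) -/
theorem orbit_three_sharp :
    (1 / 2 : ℝ) ^ 2748 < pkTauU 3 ^ (3 * 2 ^ 3) ∧ pkTauU 3 ^ (3 * 2 ^ 3) < (1 / 2 : ℝ) ^ 2747 := by
  rw [pkTauU_pow_orbit_three_eq]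
  exact one_div_sandwich_of_nat (A := 2 ^ 24) (C := 2 ^ 16 * 29491200) (Klo := 62461) (Khi := 62461)
    (K := pkK) (n := 48) (a := 2747) (by positivity) (by positivity) (by norm_num) pkK_eq.ge pkK_eq.le
    (by decide +kernel) (by decide +kernel)

/-- `pkTauU 4 ^ (4·2^4) = 1/(2^64 · (2¹⁶·46080000·pkK)^128)`. [folklore] -/
theorem pkTauU_pow_orbit_four_eq :
    pkTauU 4 ^ (4 * 2 ^ 4) = 1 / (((2 ^ 64 : ℕ) : ℝ) * (((2 ^ 16 * 46080000 : ℕ) : ℝ) * (pkK : ℝ)) ^ 128) := by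
  rw [show (4 : ℕ) * 2 ^ 4 = 64 by norm_num, pkTauU_pow_closedForm (by norm_num) 64]
  push_cast
  norm_num

/-- **`(1/2)^7410 < pkTauU 4 ^ (4·2^4) < (1/2)^7409`** — the Peierls-lever orbit defect on `ℤ⁴` to the last binary digit (interval value
`log₂ = −7409.70`; `kn`: `−16839.44`, p213528). [folklore] (numeric) -/
theorem orbit_four_sharp :
    (1 / 2 : ℝ) ^ 7410 < pkTauU 4 ^ (4 * 2 ^ 4) ∧ pkTauU 4 ^ (4 * 2 ^ 4) < (1 / 2 : ℝ) ^ 7409 := by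
  rw [pkTauU_pow_orbit_four_eq]
  exact one_div_sandwich_of_nat (A := 2 ^ 64) (C := 2 ^ 16 * 46080000) (Klo := 62461) (Khi := 62461)
    (K := pkK) (n := 128) (a := 7409) (by positivity) (by positivity) (by norm_num) pkK_eq.ge pkK_eq.le
    (by decide +kernel) (by decide +kernel)

/-- `pkTauU 5 ^ (5·2^5) = 1/(2^160 · (2¹⁶·66355200·pkK)^320)`. [folklore] -/
theorem pkTauU_pow_orbit_five_eq :
    pkTauU 5 ^ (5 * 2 ^ 5) = 1 / (((2 ^ 160 : ℕ) : ℝ) * (((2 ^ 16 * 66355200 : ℕ) : ℝ) * (pkK : ℝ)) ^ 320) := by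
  rw [show (5 : ℕ) * 2 ^ 5 = 160 by norm_num, pkTauU_pow_closedForm (by norm_num) 160]
  push_cast
  norm_num

/-- **`(1/2)^18693 < pkTauU 5 ^ (5·2^5) < (1/2)^18692`** — the Peierls-lever orbit defect on `ℤ⁵` to the last binary digit (interval value
`log₂ = −18692.60`; `kn`: `−42266.95`). [folklore] (numeric) -/
theorem orbit_five_sharp :
    (1 / 2 : ℝ) ^ 18693 < pkTauU 5 ^ (5 * 2 ^ 5) ∧ pkTauU 5 ^ (5 * 2 ^ 5) < (1 / 2 : ℝ) ^ 18692 := by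
  rw [pkTauU_pow_orbit_five_eq]
  exact one_div_sandwich_of_nat (A := 2 ^ 160) (C := 2 ^ 16 * 66355200) (Klo := 62461) (Khi := 62461)
    (K := pkK) (n := 320) (a := 18692) (by positivity) (by positivity) (by norm_num) pkK_eq.ge pkK_eq.le
    (by decide +kernel) (by decide +kernel)

/-- `pkTauU 6 ^ (6·2^6) = 1/(2^384 · (2¹⁶·90316800·pkK)^768)`. [folklore] -/
theorem pkTauU_pow_orbit_six_eq :
    pkTauU 6 ^ (6 * 2 ^ 6) = 1 / (((2 ^ 384 : ℕ) : ℝ) * (((2 ^ 16 * 90316800 : ℕ) : ℝ) * (pkK : ℝ)) ^ 768) := by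
  -- the constant first (no power above `norm_num`'s evaluation threshold appears in this step), then the exponent bookkeeping by `rw`
  have hc : (2 : ℝ) ^ 16 * ((96 * (((6 : ℕ) : ℝ) + 1)) ^ 2 * 200) * (pkK : ℝ) = ((2 ^ 16 * 90316800 : ℕ) : ℝ) * (pkK : ℝ) := by
    push_cast; norm_num
  rw [show (6 : ℕ) * 2 ^ 6 = 384 by norm_num, pkTauU_pow_closedForm (by norm_num) 384, hc, show 2 * 384 = 768 by norm_num,
    Nat.cast_pow, Nat.cast_ofNat]

/-- **`(1/2)^45204 < pkTauU 6 ^ (6·2^6) < (1/2)^45203`** — the Peierls-lever orbit defect on `ℤ⁶` to the last binary digit (interval value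
`log₂ = −45203.83`; `kn`: `−101782.28`). [folklore] (numeric) -/
theorem orbit_six_sharp :
    (1 / 2 : ℝ) ^ 45204 < pkTauU 6 ^ (6 * 2 ^ 6) ∧ pkTauU 6 ^ (6 * 2 ^ 6) < (1 / 2 : ℝ) ^ 45203 := by
  rw [pkTauU_pow_orbit_six_eq]
  exact one_div_sandwich_of_nat (A := 2 ^ 384) (C := 2 ^ 16 * 90316800) (Klo := 62461) (Khi := 62461)
    (K := pkK) (n := 768) (a := 45203) (by positivity) (by positivity) (by norm_num) pkK_eq.ge pkK_eq.le
    (by decide +kernel) (by decide +kernel)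

/-! ## Ready-to-use base inequalities for the displays (`1 − pkTauU d ^ (d·2^d) ≤ 1 − 2^{-a}`, `0 ≤ · `, base in `[0,1]`) -/

/-- `1 − pkTauU 3 ^ 24 ≤ 1 − 2^{-2748}` and `0 ≤ 1 − pkTauU 3 ^ 24`. [folklore] (numeric) -/
theorem one_sub_orbit_three_le : 1 - pkTauU 3 ^ (3 * 2 ^ 3) ≤ 1 - (1 / 2 : ℝ) ^ 2748 ∧ 0 ≤ 1 - pkTauU 3 ^ (3 * 2 ^ 3) :=
  ⟨sub_le_sub_left orbit_three_sharp.1.le 1, sub_nonneg.2 (pkTauU_pow_le_one' 3 _)⟩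

/-- `1 − pkTauU 4 ^ 64 ≤ 1 − 2^{-7410}` and `0 ≤ 1 − pkTauU 4 ^ 64`. [folklore] (numeric) -/
theorem one_sub_orbit_four_le : 1 - pkTauU 4 ^ (4 * 2 ^ 4) ≤ 1 - (1 / 2 : ℝ) ^ 7410 ∧ 0 ≤ 1 - pkTauU 4 ^ (4 * 2 ^ 4) :=
  ⟨sub_le_sub_left orbit_four_sharp.1.le 1, sub_nonneg.2 (pkTauU_pow_le_one' 4 _)⟩

/-- `1 − pkTauU 5 ^ 160 ≤ 1 − 2^{-18693}` and `0 ≤ 1 − pkTauU 5 ^ 160`. [folklore] (numeric) -/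
theorem one_sub_orbit_five_le : 1 - pkTauU 5 ^ (5 * 2 ^ 5) ≤ 1 - (1 / 2 : ℝ) ^ 18693 ∧ 0 ≤ 1 - pkTauU 5 ^ (5 * 2 ^ 5) :=
  ⟨sub_le_sub_left orbit_five_sharp.1.le 1, sub_nonneg.2 (pkTauU_pow_le_one' 5 _)⟩

/-- `1 − pkTauU 6 ^ 384 ≤ 1 − 2^{-45204}` and `0 ≤ 1 − pkTauU 6 ^ 384`. [folklore] (numeric) -/
theorem one_sub_orbit_six_le : 1 - pkTauU 6 ^ (6 * 2 ^ 6) ≤ 1 - (1 / 2 : ℝ) ^ 45204 ∧ 0 ≤ 1 - pkTauU 6 ^ (6 * 2 ^ 6) :=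
  ⟨sub_le_sub_left orbit_six_sharp.1.le 1, sub_nonneg.2 (pkTauU_pow_le_one' 6 _)⟩

/-- `0 ≤ 1 − 2^{-a} ≤ 1` for every `a`. [folklore] (numeric) -/
theorem base_mem (a : ℕ) : 0 ≤ 1 - (1 / 2 : ℝ) ^ a ∧ 1 - (1 / 2 : ℝ) ^ a ≤ 1 :=
  ⟨sub_nonneg.2 (pow_le_one₀ (by norm_num) (by norm_num)), sub_le_self 1 (by positivity)⟩

/-! ## What the lever buys, in the kernel: `pk` orbit defect versus the tree's `kn` orbit defect -/

/-- `2^b · (1/2)^(b + a) = (1/2)^a`. [folklore] (numeric) -/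
theorem two_pow_mul_half_pow_add (a b : ℕ) : (2 : ℝ) ^ b * (1 / 2 : ℝ) ^ (b + a) = (1 / 2 : ℝ) ^ a := by
  rw [pow_add, ← mul_assoc, ← mul_pow]; norm_num

/-- **`d = 3`: `2^3535 · knTauU 3 ^ 24 < pkTauU 3 ^ 24`** — the Peierls lever multiplies the per-scale defect of the displayed `ℤ³` rate by more than
`2^3535` (`kn`: `< 2⁻⁶²⁸³`; `pk`: `> 2⁻²⁷⁴⁸`).  Class unchanged (iterated logarithm).  builds on p205010 (kernel theorem, internal audit signed;
external expert review pending). [folklore] (numeric) -/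
theorem two_pow_mul_knOrbit_lt_pkOrbit_three : (2 : ℝ) ^ 3535 * knTauU 3 ^ (3 * 2 ^ 3) < pkTauU 3 ^ (3 * 2 ^ 3) :=
  calc (2 : ℝ) ^ 3535 * knTauU 3 ^ (3 * 2 ^ 3) < (2 : ℝ) ^ 3535 * (1 / 2 : ℝ) ^ (3535 + 2748) :=
        mul_lt_mul_of_pos_left (by simpa using knTauU_pow_orbit_three_lt_pow_sharp) (by positivity)
    _ = (1 / 2 : ℝ) ^ 2748 := two_pow_mul_half_pow_add 2748 3535
    _ < pkTauU 3 ^ (3 * 2 ^ 3) := orbit_three_sharp.1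

/-- **`d = 4`: `2^9429 · knTauU 4 ^ 64 < pkTauU 4 ^ 64`** (`kn`: `< 2⁻¹⁶⁸³⁹`; `pk`: `> 2⁻⁷⁴¹⁰`). [folklore] (numeric) -/
theorem two_pow_mul_knOrbit_lt_pkOrbit_four : (2 : ℝ) ^ 9429 * knTauU 4 ^ (4 * 2 ^ 4) < pkTauU 4 ^ (4 * 2 ^ 4) :=
  calc (2 : ℝ) ^ 9429 * knTauU 4 ^ (4 * 2 ^ 4) < (2 : ℝ) ^ 9429 * (1 / 2 : ℝ) ^ (9429 + 7410) :=
        mul_lt_mul_of_pos_left (by simpa using knTauU_pow_orbit_four_sharp.2) (by positivity)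
    _ = (1 / 2 : ℝ) ^ 7410 := two_pow_mul_half_pow_add 7410 9429
    _ < pkTauU 4 ^ (4 * 2 ^ 4) := orbit_four_sharp.1

/-- **`d = 5`: `2^23573 · knTauU 5 ^ 160 < pkTauU 5 ^ 160`** (`kn`: `< 2⁻⁴²²⁶⁶`; `pk`: `> 2⁻¹⁸⁶⁹³`). [folklore] (numeric) -/
theorem two_pow_mul_knOrbit_lt_pkOrbit_five : (2 : ℝ) ^ 23573 * knTauU 5 ^ (5 * 2 ^ 5) < pkTauU 5 ^ (5 * 2 ^ 5) :=
  calc (2 : ℝ) ^ 23573 * knTauU 5 ^ (5 * 2 ^ 5) < (2 : ℝ) ^ 23573 * (1 / 2 : ℝ) ^ (23573 + 18693) :=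
        mul_lt_mul_of_pos_left (by simpa using knTauU_pow_orbit_five_sharp.2) (by positivity)
    _ = (1 / 2 : ℝ) ^ 18693 := two_pow_mul_half_pow_add 18693 23573
    _ < pkTauU 5 ^ (5 * 2 ^ 5) := orbit_five_sharp.1

/-- **`d = 6`: `2^56578 · knTauU 6 ^ 384 < pkTauU 6 ^ 384`** (`kn`: `< 2⁻¹⁰¹⁷⁸²`; `pk`: `> 2⁻⁴⁵²⁰⁴`). [folklore] (numeric) -/
theorem two_pow_mul_knOrbit_lt_pkOrbit_six : (2 : ℝ) ^ 56578 * knTauU 6 ^ (6 * 2 ^ 6) < pkTauU 6 ^ (6 * 2 ^ 6) :=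
  calc (2 : ℝ) ^ 56578 * knTauU 6 ^ (6 * 2 ^ 6) < (2 : ℝ) ^ 56578 * (1 / 2 : ℝ) ^ (56578 + 45204) :=
        mul_lt_mul_of_pos_left (by simpa using knTauU_pow_orbit_six_sharp.2) (by positivity)
    _ = (1 / 2 : ℝ) ^ 45204 := two_pow_mul_half_pow_add 45204 56578
    _ < pkTauU 6 ^ (6 * 2 ^ 6) := orbit_six_sharp.1

/-! ## Honest size of a display with base `1 − 2⁻²⁷⁴⁸` (the `d = 3` Peierls-lever base), Bernoulli only -/

/-- `2^2747 · 2^{-2748} = 1/2`. [folklore] (numeric) -/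
theorem two_pow_mul_orbitDefect : ((2 ^ 2747 : ℕ) : ℝ) * (1 / 2 : ℝ) ^ 2748 = 1 / 2 := by
  have h : (1 / 2 : ℝ) ^ 2748 = (1 / 2 : ℝ) ^ 2747 * (1 / 2) := pow_succ _ _
  rw [h, Nat.cast_pow, Nat.cast_ofNat, ← mul_assoc, ← mul_pow]
  norm_num

/-- `2^2748 · 2^{-2748} = 1`. [folklore] (numeric) -/
theorem two_pow_mul_orbitDefect' : ((2 ^ 2748 : ℕ) : ℝ) * (1 / 2 : ℝ) ^ 2748 = 1 := by
  rw [Nat.cast_pow, Nat.cast_ofNat, ← mul_pow]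
  norm_num

/-- **HONEST SIZE, lower side**: `(1 − 2⁻²⁷⁴⁸)^e ≥ 1/2` for every `e ≤ 2^2747` — a majorant printed with the Peierls-lever base has not halved
before its exponent (for the displays: `⌊(log*₂ N − 6)/2⌋`) exceeds `2^2747`. [folklore] (numeric) -/
theorem half_le_base_pow {e : ℕ} (he : e ≤ 2 ^ 2747) : 1 / 2 ≤ (1 - (1 / 2 : ℝ) ^ 2748) ^ e :=
  half_le_one_sub_pow (by positivity) (pow_le_one₀ (by norm_num) (by norm_num)) two_pow_mul_orbitDefect.le he

/-- **HONEST SIZE, upper side**: `(1 − 2⁻²⁷⁴⁸)^e ≤ 1/2` for every `e ≥ 2^2748`. [folklore] (numeric) -/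
theorem base_pow_le_half {e : ℕ} (he : 2 ^ 2748 ≤ e) : (1 - (1 / 2 : ℝ) ^ 2748) ^ e ≤ 1 / 2 :=
  one_sub_pow_le_half (by positivity) (pow_le_one₀ (by norm_num) (by norm_num)) two_pow_mul_orbitDefect'.ge he

end Summit.CriticalPhenomena.PercolationContinuityZ3.Theorems.Quant.PkSharp

end
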